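/-
Copyright (c) 2026 the pub-hodgecm-mathlib formalisation cell (harness21).  Prover seat hodgecm-mathlib-K2Liu-p11 (g5), Track B «K2-LIT», #184♮ = hLiu418 =
`stmt-HodgeConjecture-24832`; socket #41, KIND W, brick (3c) part 2: THE `hBL` ASSEMBLER (KW desk F0P2-p08 (g4) 2026-09-05T01:25:09Z (B); architect K2E3-p11 (g10) 01:31:42Z).
THEOREMS ONLY (no `def`, no `instance`, no notation, no named-fact hypothesis, no `sorry`, default heartbeats).
-/
import Summits.HodgeConjecture.HodgeConjecture.Theorems.K2LiuKindWArchBlockGrowthConversion   -- ★ (3c) part 1 (this seat): `placeFace_le_of_iwasawa`, `rpow_le_of_two_sided_height`; brings ★ (3b)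
import Summits.HodgeConjecture.HodgeConjecture.Theorems.K2LiuKindWArchFramedIndexHermitian    -- ★ (x-a-heb) part 2: `framedIndex_det_ne_zero_of_frame`; brings the frames, `frame_mem`, `frame_mul`
import Summits.HodgeConjecture.HodgeConjecture.Theorems.K2LiuKindWArchLetterDefs             -- ★ p863152: `kindWArchLetter`, `archWhittakerIntegral`, `kindWArchLetter_eqOn`
import Summits.HodgeConjecture.HodgeConjecture.Theorems.K2LiuHermitianTubeAction             -- ★ `exists_transl_levi_mul_stabilizer` (the hermitian-`R` Iwasawa decomposition in `U(J)`)
import Summits.HodgeConjecture.HodgeConjecture.Theorems.K2LiuLadderIntertwinerScalars        -- ★ `differentiableOn_finset_prod`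
import Summits.HodgeConjecture.HodgeConjecture.Theorems.K2LiuKindWArchFrameHeightLetter       -- ★ p864255 (L7-height) `hHt_of_frame`; brings ★ G7-C `exists_adelicHeightGL_floor`
import HarnessLib

/-!
# Crux `HLiu418`, socket #41, KIND W — brick (3c) part 2: THE (iii-arch) BLOCK LETTER `hBL` FROM THE PER-PLACE GROWTH OF THE CONTINUED WHITTAKER LETTERS

Cell `hodgecm-mathlib`, hLiu418 = `stmt-HodgeConjecture-24832` (helper lane, count-neutral), route of record `HCCMUnconditional`; squad K2 ∕ K2Liu, socket #41, KIND W.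
THE TARGET.  The (iii-arch) letter `hBL` of ★ `K2LiuKindWBlockOfRecordCMOfLocalLettersHaar.kindW_block_cm_of_localLetters_haar` (:170–185) at the frames of record
(`Sinf = {w ∕∕ IsComplex}`, `φ σ = σ`, `A σ = −2•(T σ)₂₂`, `B σ = (T σ⁻¹)₁₁` — so `A σ·σ(S)·B σ = h_σ(S)`, the framed index of ★ p863806 — `er = e₂`, `Kt = 1`).
THE ROAD (architect K2E3-p11 (g10), desk (KW-R5)).  By the canonicity ★ `kindWArchLetter_eqOn`, the guarded reading `Finf j S · h = kindWArchLetter …` is ANY holomorphic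
function on `{0 < re}` agreeing with the arch Whittaker integral on `{1 < re}`; the EXPLICIT (x-a) chain (L1) writes that integral as `Cst(s)·Σ_i c_{j,i}·cν·∏_w Ew_{i,w}(s)`
for EVERY family of per-place continuations `Ew` with the twisted-integral formula; (L2) supplies such continuations with a UNIFORM (ii″) growth face in the hermitian-`R`
Iwasawa letters; ★ `exists_transl_levi_mul_stabilizer` produces those letters for `diag(C_w,−B_w)·Fr(h_∞·g) w ∈ U(J)`; ★ (3c) part 1 `placeFace_le_of_iwasawa` converts the
face to the `hBL` reading; the product over the places splits, `(∏_w ‖det y_w‖)^{2−2re s} ≤ Ch^E·c₁^{−ah·E}·H(h)^{ah·E}` by the two-sided height letter ★ p864255 `hHt_of_frame`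
(BY NAME) and the height floor ★ `exists_adelicHeightGL_floor` (§2 `rpow_le_of_two_sided_height_floor`), and `(∏_w ‖det C_w‖)^{2−2re s}`, `|Cst(s)|` are bounded on the ball.
§1 `norm_chain_le`; §2 `prod_face_split`, `tail_bound`, `rpow_le_of_two_sided_height_floor` (folklore real algebra); §3 **`hBL_of_placeGrowth`**.
[Shimura1982, §3 Thm. 3.1, §4 Thm. 4.2] [Shimura1997, §16.4, §18.4] [KudlaRallis1994, §1–§2] [BorelJacquet1979, §1.2, §4.1].
HONEST LABEL.  Count-neutral helper; closes no socket by itself: `HC_CM` is proved only modulo the 7 printed citations (2 remaining named inputs: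
hLiu418 = `stmt-HodgeConjecture-24832`, h413 = `stmt-HodgeConjecture-24833`) until rung 0 closes.  NOT HERE (by value): (L1) the explicit chain ((3a) ∘ (3a′)),
(L2) the uniform per-place growth (`hWgrU_of_record`).  (L3) is ★ p864255 BY NAME.

## References
* [Shimura1982] G. Shimura, *Confluent hypergeometric functions on tube domains*, Math. Ann. 260 (1982), §3 Thm. 3.1, §4 Thm. 4.2.
* [Shimura1997] G. Shimura, *Euler Products and Eisenstein Series*, CBMS 93 (1997), §16.4, §18.4.
* [KudlaRallis1994] S. Kudla, S. Rallis, Ann. of Math. 140 (1994), §1–§2.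
* [BorelJacquet1979] A. Borel, H. Jacquet, Proc. Symp. Pure Math. 33 (1979), §1.2 (heights), §4.1.
-/

set_option autoImplicit false
set_option linter.dupNamespace false -- the mandated namespace repeats `HodgeConjecture.HodgeConjecture`

noncomputable section

open scoped Matrix ComplexConjugate Classical
open Complex Matrix MeasureTheory MeasureTheory.Measure NumberField NumberField.InfinitePlace IsDedekindDomain
open Literature.NumberTheory.ModularForms.SiegelUpperHalfSpace (moeb)
open Literature.NumberTheory.Automorphic Literature.NumberTheory.Automorphic.UnitaryGroup Literature.NumberTheory.GaloisRepresentations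
open Literature.NumberTheory.GelbartRogawski1991 Literature.NumberTheory.GelbartRogawski1991.GRConstruction
open Literature.NumberTheory.GelbartRogawski1991.UnitaryDualPair
open Literature.NumberTheory.K2Lit.SiegelDoubled

namespace Summit.HodgeConjecture.HodgeConjecture.Cruxes.HLiu418.K2LiuKindWArchBlockLetterOfPlaceGrowth

open K2LiuU22CompactPictureDefs K2LiuArchInducedTubeDefs K2LiuSiegelUnipotentLocalDefs
open K2LiuSiegelUnipotentFourierDefs (skewMatrices unipDeltaChar)
open K2LiuSiegelEisensteinKindWLetters (kindWFinset)
open K2LiuKindWArchLetterDefs (archWhittakerIntegral kindWArchLetter kindWArchLetter_eqOn)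
open K2LiuHolTubeRigidityOfFrame (frame_mem frame_mul)
open K2LiuHermitianTubeCocycle (mul_mem_UJ levi_mem_iff)
open K2LiuHermitianTubeAction (exists_transl_levi_mul_stabilizer)
open K2LiuArchBlockOfFrame (antidiag_letters)
open K2LiuLadderIntertwinerScalars (differentiableOn_finset_prod)
open K2LiuKindWArchFramedIndexHermitian (framedIndex_det_ne_zero_of_frame)
open K2LiuKindWArchBlockGrowthConversion (placeFace_le_of_iwasawa rpow_le_of_two_sided_height)
open K2LiuKindWArchFrameHeightLetter (hHt_of_frame)
open K2LiuIwasawaHeightLatticeSumBound (exists_adelicHeightGL_floor)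

/-! ## §1 Norm of the explicit chain -/

/-- **`‖Cst·Σ_i c_i·(cν·∏_w E_{i,w})‖ ≤ ‖Cst‖·(Σ_i ‖c_i‖)·|cν|·∏_w F_w`** whenever `‖E_{i,w}‖ ≤ F_w` with `F_w ≥ 0` independent of `i`. [folklore] -/
theorem norm_chain_le {ι W : Type*} [Fintype ι] [Fintype W] (Cst : ℂ) (c : ι → ℂ) (cν : ℝ) (E : ι → W → ℂ) (F : W → ℝ)
    (hF : ∀ w, 0 ≤ F w) (hE : ∀ i w, ‖E i w‖ ≤ F w) :
    ‖Cst * ∑ i, c i * ((cν : ℂ) * ∏ w, E i w)‖ ≤ ‖Cst‖ * (∑ i, ‖c i‖) * |cν| * ∏ w, F w := by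
  have hprod : ∀ i, ‖∏ w, E i w‖ ≤ ∏ w, F w := fun i => by
    rw [norm_prod]
    exact Finset.prod_le_prod (fun w _ => norm_nonneg _) fun w _ => hE i w
  have hPF : 0 ≤ ∏ w, F w := Finset.prod_nonneg fun w _ => hF w
  calc ‖Cst * ∑ i, c i * ((cν : ℂ) * ∏ w, E i w)‖ = ‖Cst‖ * ‖∑ i, c i * ((cν : ℂ) * ∏ w, E i w)‖ := norm_mul _ _
    _ ≤ ‖Cst‖ * ∑ i, ‖c i‖ * (|cν| * ∏ w, F w) := by
        refine mul_le_mul_of_nonneg_left ((norm_sum_le _ _).trans (Finset.sum_le_sum fun i _ => ?_)) (norm_nonneg _)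
        rw [norm_mul, norm_mul, Complex.norm_real, Real.norm_eq_abs]
        exact mul_le_mul_of_nonneg_left (mul_le_mul_of_nonneg_left (hprod i) (abs_nonneg _)) (norm_nonneg _)
    _ = ‖Cst‖ * (∑ i, ‖c i‖) * |cν| * ∏ w, F w := by rw [← Finset.sum_mul]; ring

/-! ## §2 The product of the converted faces over the complex places -/

/-- **product split**: `∏_w (K·(P_w·Y_w)^e·Z_w) = K^{#W}·(∏_w P_w)^e·(∏_w Y_w)^e·∏_w Z_w` for `P_w, Y_w ≥ 0`. [folklore] -/
theorem prod_face_split {W : Type*} [Fintype W] (K e : ℝ) (P Y Z : W → ℝ) (hP : ∀ w, 0 ≤ P w) (hY : ∀ w, 0 ≤ Y w) :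
    ∏ w, K * (P w * Y w) ^ e * Z w = K ^ Fintype.card W * (∏ w, P w) ^ e * (∏ w, Y w) ^ e * ∏ w, Z w := by
  have h1 : (∏ w, P w) ^ e = ∏ w, P w ^ e := (Real.finsetProd_rpow _ _ (fun w _ => hP w) e).symm
  have h2 : (∏ w, Y w) ^ e = ∏ w, Y w ^ e := (Real.finsetProd_rpow _ _ (fun w _ => hY w) e).symm
  have h3 : K ^ Fintype.card W = ∏ _w : W, K := by rw [Finset.prod_const, Finset.card_univ]
  rw [h1, h2, h3, ← Finset.prod_mul_distrib, ← Finset.prod_mul_distrib, ← Finset.prod_mul_distrib]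
  refine Finset.prod_congr rfl fun w _ => ?_
  rw [Real.mul_rpow (hP w) (hY w)]
  ring

/-- **tail bound**: `a·b·c·(K·Pe·Ye·Z) ≤ a'·b'·c·(K·CCE·ChE)·HE·Z` from `a ≤ a'`, `b ≤ b'`, `Pe ≤ CCE`, `Ye ≤ ChE·HE` and the evident signs. [folklore] -/
theorem tail_bound {a b c a' b' K Pe Ye CCE ChE HE Z : ℝ} (ha : a ≤ a') (hb : b ≤ b') (ha' : 0 ≤ a') (hb0 : 0 ≤ b) (hc : 0 ≤ c) (hK : 0 ≤ K)
    (hPe0 : 0 ≤ Pe) (hPe : Pe ≤ CCE) (hYe0 : 0 ≤ Ye) (hYe : Ye ≤ ChE * HE) (hCCE : 0 ≤ CCE) (hZ : 0 ≤ Z) :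
    a * b * c * (K * Pe * Ye * Z) ≤ a' * b' * c * (K * CCE * ChE) * HE * Z := by
  have h1 : a * b * c ≤ a' * b' * c := mul_le_mul_of_nonneg_right (mul_le_mul ha hb hb0 ha') hc
  have h2 : K * Pe * Ye * Z ≤ K * CCE * (ChE * HE) * Z :=
    mul_le_mul_of_nonneg_right (mul_le_mul (mul_le_mul_of_nonneg_left hPe hK) hYe hYe0 (mul_nonneg hK hCCE)) hZ
  calc a * b * c * (K * Pe * Ye * Z) ≤ a' * b' * c * (K * CCE * (ChE * HE) * Z) :=
        mul_le_mul h1 h2 (mul_nonneg (mul_nonneg (mul_nonneg hK hPe0) hYe0) hZ) (mul_nonneg (mul_nonneg ha' (hb0.trans hb)) hc)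
    _ = a' * b' * c * (K * CCE * ChE) * HE * Z := by ring

/-- **two-sided height bound with a floor**: `0 < c₁ ≤ 1`, `c₁ ≤ H`, `P ≤ Ch·H^{ah}`, `P⁻¹ ≤ Ch·H^{ah}`, `|e| ≤ E` ⇒ `P^e ≤ Ch^E·c₁^{−ah·E}·H^{ah·E}` (★ p864165
`rpow_le_of_two_sided_height` at `H/c₁ ≥ 1`). [folklore] -/
theorem rpow_le_of_two_sided_height_floor {P Ch ah H c₁ e E : ℝ} (hP : 0 < P) (hCh : 1 ≤ Ch) (hah : 0 ≤ ah) (hc₁ : 0 < c₁) (hc₁1 : c₁ ≤ 1)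
    (hH : c₁ ≤ H) (h1 : P ≤ Ch * H ^ ah) (h2 : P⁻¹ ≤ Ch * H ^ ah) (he : |e| ≤ E) : P ^ e ≤ Ch ^ E * c₁ ^ (-(ah * E)) * H ^ (ah * E) := by
  have hH0 : 0 < H := lt_of_lt_of_le hc₁ hH
  have hmono : H ^ ah ≤ (H / c₁) ^ ah := Real.rpow_le_rpow hH0.le ((le_div_iff₀ hc₁).2 (mul_le_of_le_one_right hH0.le hc₁1)) hah
  have hCh0 : 0 ≤ Ch := le_trans zero_le_one hCh
  calc P ^ e ≤ Ch ^ E * (H / c₁) ^ (ah * E) := rpow_le_of_two_sided_height hP hCh hah ((one_le_div hc₁).2 hH)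
        (h1.trans (mul_le_mul_of_nonneg_left hmono hCh0)) (h2.trans (mul_le_mul_of_nonneg_left hmono hCh0)) he
    _ = Ch ^ E * c₁ ^ (-(ah * E)) * H ^ (ah * E) := by rw [Real.div_rpow hH0.le hc₁.le, Real.rpow_neg hc₁.le, div_eq_mul_inv]; ring

/-! ## §3 THE HEAD: `hBL` from the explicit chain, the uniform per-place growth and the height letter -/

section Head

variable (L : Type) [Field L] [NumberField L] [IsCMField L]
variable {N₀ M₀ : ℕ} (e : Fin N₀ × Fin M₀ ≃ Fin 2)
  (dV : Fin N₀ → L) (hdV : ∀ i, IsCMField.complexConj L (dV i) = dV i)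
  (dW : Fin M₀ → L) (hdW : ∀ i, IsCMField.complexConj L (dW i) = dW i)
  [MeasurableSpace ↥(unipDeltaArch L e dV hdV dW hdW)]

/-- **THE (iii-arch) BLOCK LETTER `hBL` FROM THE PER-PLACE GROWTH** (★ p863724 :170–185 VERBATIM at the frames of record `Sinf = {w : InfinitePlace L // w.IsComplex}`, `φ σ = σ.1.embedding`,
`A σ = −2•(T σ)₂₂`, `B σ = (Tinv σ)₁₁`, `er = e₂`).  Inputs: the closed-form frames of record `(T, Tinv)` with `(Fr, hFr, hT2, hTU)`, the anti-diagonal base point `(Bx, Cx)` in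
`U(J)` with `Cx` invertible, the conjugator `g`; the size frames `(A, B)` read off `(T, Tinv)`; the compact bound `M ≥ 1`; the carriers, the (KW-fac) arch factors `FinfT` and the
GUARDED reading of `Finf`; pictures `Q : W → ιQ → Carrier`, weights `k`, abscissa `s₁ ≤ 1`; and BY VALUE (L1) the explicit (x-a) chain `hchain` (coefficients `c`, carrier constant
`cν`, scalar `Cst s = xK^{2(s−s₀)}`), (L2) the UNIFORM per-place growth `hWgrU` (★ `hWgrU_of_record`'s shape), (L3) the two-sided height letter `hHY`.  THEN `hBL`.
[cite: Shimura1982, §3 Thm. 3.1, §4 Thm. 4.2] [cite: Shimura1997, §16.4, §18.4] [cite: KudlaRallis1994, §1–§2] [cite: BorelJacquet1979, §1.2, §4.1] -/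
theorem hBL_of_placeGrowth (hdV0 : ∀ i, dV i ≠ 0) (hdW0 : ∀ i, dW i ≠ 0)
    (T Tinv : {w : InfinitePlace L // w.IsComplex} → Matrix (Fin 2 ⊕ Fin 2) (Fin 2 ⊕ Fin 2) ℂ)
    (hTdef : ∀ w, T w = fromBlocks (diagonal (fun k => (Real.sqrt (|(w.1.embedding (dV (e.symm k).1 * dW (e.symm k).2)).re| / 2) : ℂ))) (diagonal (fun k => (Real.sqrt (|(w.1.embedding (dV (e.symm k).1 * dW (e.symm k).2)).re| / 2) : ℂ)))
      (diagonal (fun k => I * ((((w.1.embedding (dV (e.symm k).1 * dW (e.symm k).2)).re / |(w.1.embedding (dV (e.symm k).1 * dW (e.symm k).2)).re|) * Real.sqrt (|(w.1.embedding (dV (e.symm k).1 * dW (e.symm k).2)).re| / 2) : ℝ) : ℂ))) (-diagonal (fun k => I * ((((w.1.embedding (dV (e.symm k).1 * dW (e.symm k).2)).re / |(w.1.embedding (dV (e.symm k).1 * dW (e.symm k).2)).re|) * Real.sqrt (|(w.1.embedding (dV (e.symm k).1 * dW (e.symm k).2)).re| / 2) : ℝ) : ℂ))))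
    (hTinvdef : ∀ w, Tinv w = fromBlocks (diagonal (fun k => (((Real.sqrt (|(w.1.embedding (dV (e.symm k).1 * dW (e.symm k).2)).re| / 2))⁻¹ / 2 : ℝ) : ℂ))) (-diagonal (fun k => I * (((Real.sqrt (|(w.1.embedding (dV (e.symm k).1 * dW (e.symm k).2)).re| / 2))⁻¹ * ((w.1.embedding (dV (e.symm k).1 * dW (e.symm k).2)).re / |(w.1.embedding (dV (e.symm k).1 * dW (e.symm k).2)).re|) / 2 : ℝ) : ℂ)))
      (diagonal (fun k => (((Real.sqrt (|(w.1.embedding (dV (e.symm k).1 * dW (e.symm k).2)).re| / 2))⁻¹ / 2 : ℝ) : ℂ))) (diagonal (fun k => I * (((Real.sqrt (|(w.1.embedding (dV (e.symm k).1 * dW (e.symm k).2)).re| / 2))⁻¹ * ((w.1.embedding (dV (e.symm k).1 * dW (e.symm k).2)).re / |(w.1.embedding (dV (e.symm k).1 * dW (e.symm k).2)).re|) / 2 : ℝ) : ℂ))))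
    (Fr : UnitaryGroup.arch (Fp L) L (IsCMField.complexConj L) (2 + 2) (hermD L e dV hdV dW hdW) → {w : InfinitePlace L // w.IsComplex} → Matrix (Fin 2 ⊕ Fin 2) (Fin 2 ⊕ Fin 2) ℂ)
    (hFr : ∀ a w, Fr a w = T w * Matrix.reindex (e₂ (n := 2)).symm (e₂ (n := 2)).symm
      (((UnitaryGroup.archAt (Fp L) L (IsCMField.complexConj L) (2 + 2) (hermD L e dV hdV dW hdW) w
        (UnitaryGroup.complexConj_smul_infinitePlace L w.1) (IsCMField.complexConj_ne_one L) a :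
          UnitaryGroup.archLocal L (2 + 2) (hermD L e dV hdV dW hdW) w) : GL (Fin (2 + 2)) ℂ) : Matrix (Fin (2 + 2)) (Fin (2 + 2)) ℂ) * Tinv w)
    (hT2 : ∀ w, Tinv w * T w = 1)
    (hTU : ∀ w (g : GL (Fin (2 + 2)) ℂ), g ∈ UnitaryGroup.archLocal L (2 + 2) (hermD L e dV hdV dW hdW) w →
      (T w * Matrix.reindex (e₂ (n := 2)).symm (e₂ (n := 2)).symm (g : Matrix _ _ ℂ) * Tinv w)ᴴ * Matrix.J (Fin 2) ℂ *
        (T w * Matrix.reindex (e₂ (n := 2)).symm (e₂ (n := 2)).symm (g : Matrix _ _ ℂ) * Tinv w) = Matrix.J (Fin 2) ℂ)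
    (Bx Cx : {w : InfinitePlace L // w.IsComplex} → Matrix (Fin 2) (Fin 2) ℂ)
    (hx : ∀ w, (fromBlocks 0 (Bx w) (Cx w) 0 : Matrix (Fin 2 ⊕ Fin 2) (Fin 2 ⊕ Fin 2) ℂ)ᴴ * Matrix.J (Fin 2) ℂ *
      (fromBlocks 0 (Bx w) (Cx w) 0 : Matrix (Fin 2 ⊕ Fin 2) (Fin 2 ⊕ Fin 2) ℂ) = Matrix.J (Fin 2) ℂ)
    (hCu : ∀ w, IsUnit (Cx w).det) (g : UnitaryGroup.arch (Fp L) L (IsCMField.complexConj L) (2 + 2) (hermD L e dV hdV dW hdW))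
    (A B : {w : InfinitePlace L // w.IsComplex} → Matrix (Fin 2) (Fin 2) ℂ) (hA : ∀ σ, A σ = (-2 : ℂ) • (T σ).toBlocks₂₂) (hB : ∀ σ, B σ = (Tinv σ).toBlocks₁₁)
    {M : ℝ} (hM : 1 ≤ M) (hT1 : ∀ w, T w * Tinv w = 1) (hTe : ∀ w i j, ‖T w i j‖ ≤ M) (hTe' : ∀ w i j, ‖Tinv w i j‖ ≤ M)
    (T₀ : Finset (HeightOneSpectrum (𝓞 (Fp L))))
    (νinf : Finset (HeightOneSpectrum (𝓞 (Fp L))) → Measure ↥(unipDeltaArch L e dV hdV dW hdW)) {m : ℕ}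
    (FinfT : Fin m → skewMatrices ((IsCMField.complexConj L : L ≃ₐ[Fp L] L) : L →+* L) ((gramR L e dV hdV dW hdW).map (algebraMap (Fp L) L)) →
      HA L e dV hdV dW hdW → ℂ → UnitaryGroup.arch (Fp L) L (IsCMField.complexConj L) (2 + 2) (hermD L e dV hdV dW hdW) → ℂ)
    (Finf : Fin m → skewMatrices ((IsCMField.complexConj L : L ≃ₐ[Fp L] L) : L →+* L) ((gramR L e dV hdV dW hdW).map (algebraMap (Fp L) L)) → ℂ → HA L e dV hdV dW hdW → ℂ)
    (hFinf : ∀ j S s h, Finf j S s h = if (S : Matrix (Fin 2) (Fin 2) L).det = 0 then 0 else kindWArchLetter L e dV hdV dW hdW νinf T₀ FinfT j S s h)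
    {ιQ : Type} [Fintype ιQ] (Q : {w : InfinitePlace L // w.IsComplex} → ιQ → Carrier) (k : {w : InfinitePlace L // w.IsComplex} → ℤ) (s₁ : ℝ) (hs₁ : s₁ ≤ 1)
    -- (L1) the explicit (x-a) chain
    (c : Fin m → ιQ → ℂ) (cν : ℝ) (Cst : ℂ → ℂ) (xK : ℝ) (hxK : 0 < xK) (s₀ : ℂ) (hCst : ∀ s, Cst s = ((xK : ℝ) : ℂ) ^ (2 * (s - s₀)))
    (hchain : ∀ Ew : ιQ → skewMatrices ((IsCMField.complexConj L : L ≃ₐ[Fp L] L) : L →+* L) ((gramR L e dV hdV dW hdW).map (algebraMap (Fp L) L)) → HA L e dV hdV dW hdW → {w : InfinitePlace L // w.IsComplex} → ℂ → ℂ,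
      (∀ (i : ιQ) (S : skewMatrices ((IsCMField.complexConj L : L ≃ₐ[Fp L] L) : L →+* L) ((gramR L e dV hdV dW hdW).map (algebraMap (Fp L) L))) (h : HA L e dV hdV dW hdW) (w : {w : InfinitePlace L // w.IsComplex}),
        (S : Matrix (Fin 2) (Fin 2) L).det ≠ 0 → ∀ s : ℂ, s₁ < s.re →
        ∀ F : Matrix (Fin 2 ⊕ Fin 2) (Fin 2 ⊕ Fin 2) ℂ → ℂ, IsArchSiegelSection (fun z : ℂ => (conj z / ((‖z‖ : ℝ) : ℂ)) ^ (k w)) s F →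
          (∀ (v : Matrix (Fin 2) (Fin 2) ℂ), vᴴ * v = 1 → ∀ hv : v.det ≠ 0,
            F ((2 : ℂ)⁻¹ • fromBlocks (1 + v) (-(I • (1 - v))) (I • (1 - v)) (1 + v) : Matrix (Fin 2 ⊕ Fin 2) (Fin 2 ⊕ Fin 2) ℂ) = evalAt v hv (Q w i)) →
          ∫ x : Fin 2 → Fin 2 → ℝ, F ((fromBlocks 0 (Bx w) (Cx w) 0 : Matrix (Fin 2 ⊕ Fin 2) (Fin 2 ⊕ Fin 2) ℂ) * fromBlocks 1 (hermOfReal x) 0 1 *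
              Fr (UnitaryGroup.archPart (Fp L) L (IsCMField.complexConj L) (2 + 2) (hermD L e dV hdV dW hdW) h * g) w) *
            cexp (-(2 * Real.pi * I) * (((-2 : ℂ) • ((T w).toBlocks₂₂ * (S : Matrix (Fin 2) (Fin 2) L).map w.1.embedding * (Tinv w).toBlocks₁₁)) * hermOfReal x).trace) = Ew i S h w s) →
      ∀ (j : Fin m) (S : skewMatrices ((IsCMField.complexConj L : L ≃ₐ[Fp L] L) : L →+* L) ((gramR L e dV hdV dW hdW).map (algebraMap (Fp L) L))) (h : HA L e dV hdV dW hdW) (s : ℂ),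
        (S : Matrix (Fin 2) (Fin 2) L).det ≠ 0 → s₁ < s.re →
        archWhittakerIntegral L e dV hdV dW hdW (νinf (kindWFinset L e dV hdV dW hdW T₀ (S : Matrix (Fin 2) (Fin 2) L) h)) (S : Matrix (Fin 2) (Fin 2) L)
          (FinfT j S h) (UnitaryGroup.archPart (Fp L) L (IsCMField.complexConj L) (2 + 2) (hermD L e dV hdV dW hdW) h) s =
        Cst s * ∑ i, c j i * ((cν : ℂ) * ∏ w, Ew i S h w s))
    -- (L2) the UNIFORM per-place growth of the continued letters (★ `hWgrU_of_record`'s shape)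
    (hWgrU : ∀ z : ℂ, 0 < z.re → ∃ Cg cg N N' r : ℝ, 0 ≤ Cg ∧ 0 < cg ∧ 0 ≤ N ∧ 0 ≤ N' ∧ 0 < r ∧
      ∀ (w : {w : InfinitePlace L // w.IsComplex}) (i : ιQ) (S : skewMatrices ((IsCMField.complexConj L : L ≃ₐ[Fp L] L) : L →+* L) ((gramR L e dV hdV dW hdW).map (algebraMap (Fp L) L))), (S : Matrix (Fin 2) (Fin 2) L).det ≠ 0 → ∀ (h : HA L e dV hdV dW hdW),
        ∃ Ew : ℂ → ℂ, DifferentiableOn ℂ Ew {s : ℂ | 0 < s.re} ∧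
          (∀ s : ℂ, s₁ < s.re → ∀ F : Matrix (Fin 2 ⊕ Fin 2) (Fin 2 ⊕ Fin 2) ℂ → ℂ, IsArchSiegelSection (fun z : ℂ => (conj z / ((‖z‖ : ℝ) : ℂ)) ^ (k w)) s F →
            (∀ (v : Matrix (Fin 2) (Fin 2) ℂ), vᴴ * v = 1 → ∀ hv : v.det ≠ 0,
              F ((2 : ℂ)⁻¹ • fromBlocks (1 + v) (-(I • (1 - v))) (I • (1 - v)) (1 + v) : Matrix (Fin 2 ⊕ Fin 2) (Fin 2 ⊕ Fin 2) ℂ) = evalAt v hv (Q w i)) →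
            ∫ x : Fin 2 → Fin 2 → ℝ, F ((fromBlocks 0 (Bx w) (Cx w) 0 : Matrix (Fin 2 ⊕ Fin 2) (Fin 2 ⊕ Fin 2) ℂ) * fromBlocks 1 (hermOfReal x) 0 1 *
                Fr (UnitaryGroup.archPart (Fp L) L (IsCMField.complexConj L) (2 + 2) (hermD L e dV hdV dW hdW) h * g) w) *
              cexp (-(2 * Real.pi * I) * (((-2 : ℂ) • ((T w).toBlocks₂₂ * (S : Matrix (Fin 2) (Fin 2) L).map w.1.embedding * (Tinv w).toBlocks₁₁)) * hermOfReal x).trace) = Ew s) ∧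
          ∀ s : ℂ, dist s z < r →
            ∀ (X₀ R : Matrix (Fin 2) (Fin 2) ℂ) (u₀ : Matrix (Fin 2 ⊕ Fin 2) (Fin 2 ⊕ Fin 2) ℂ), X₀ᴴ = X₀ → Rᴴ = R → IsUnit R.det →
              u₀ᴴ * Matrix.J (Fin 2) ℂ * u₀ = Matrix.J (Fin 2) ℂ → moeb u₀ (I • (1 : Matrix (Fin 2) (Fin 2) ℂ)) = I • 1 →
              (fromBlocks (Cx w) 0 0 (-(Bx w)) : Matrix (Fin 2 ⊕ Fin 2) (Fin 2 ⊕ Fin 2) ℂ) *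
                  Fr (UnitaryGroup.archPart (Fp L) L (IsCMField.complexConj L) (2 + 2) (hermD L e dV hdV dW hdW) h * g) w = fromBlocks 1 X₀ 0 1 * fromBlocks R 0 0 R⁻¹ * u₀ →
              ‖Ew s‖ ≤ Cg * ‖R.det‖ ^ (2 - 2 * s.re) * Real.exp (-(cg * ∑ a, ∑ b, ‖(R * (((Cx w)⁻¹)ᴴ * ((-2 : ℂ) • ((T w).toBlocks₂₂ * (S : Matrix (Fin 2) (Fin 2) L).map w.1.embedding * (Tinv w).toBlocks₁₁)) * (Cx w)⁻¹) * R) a b‖)) *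
                (1 + ∑ a, ∑ b, ‖(R * (((Cx w)⁻¹)ᴴ * ((-2 : ℂ) • ((T w).toBlocks₂₂ * (S : Matrix (Fin 2) (Fin 2) L).map w.1.embedding * (Tinv w).toBlocks₁₁)) * (Cx w)⁻¹) * R) a b‖) ^ N *
                (1 + ‖(R * (((Cx w)⁻¹)ᴴ * ((-2 : ℂ) • ((T w).toBlocks₂₂ * (S : Matrix (Fin 2) (Fin 2) L).map w.1.embedding * (Tinv w).toBlocks₁₁)) * (Cx w)⁻¹) * R).det‖ ^ (-N'))) :
    ∀ z : ℂ, 0 < z.re → ∃ (cg Ng N'g Kt C a r : ℝ), 0 < cg ∧ 0 ≤ Ng ∧ 0 ≤ N'g ∧ 1 ≤ Kt ∧ 0 ≤ C ∧ 0 ≤ a ∧ 0 < r ∧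
      ∀ (j : Fin m) (S : skewMatrices ((IsCMField.complexConj L : L ≃ₐ[Fp L] L) : L →+* L) ((gramR L e dV hdV dW hdW).map (algebraMap (Fp L) L))) (s : ℂ),
      dist s z < r → (S : Matrix (Fin 2) (Fin 2) L).det ≠ 0 →
      ∀ (h : HA L e dV hdV dW hdW) (y b d : {w : InfinitePlace L // w.IsComplex} → Matrix (Fin 2) (Fin 2) ℂ) (κ κ' : {w : InfinitePlace L // w.IsComplex} → Matrix (Fin 2 ⊕ Fin 2) (Fin 2 ⊕ Fin 2) ℂ),
      (∀ σ, κ σ * κ' σ = 1) → (∀ σ, κ' σ * κ σ = 1) → (∀ σ i j, ‖κ σ i j‖ ≤ M) → (∀ σ i j, ‖κ' σ i j‖ ≤ M) →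
      (∀ σ, T σ * Matrix.reindex (e₂ (n := 2)).symm (e₂ (n := 2)).symm
          (((UnitaryGroup.archAt (Fp L) L (IsCMField.complexConj L) (2 + 2) (hermD L e dV hdV dW hdW) σ
              (UnitaryGroup.complexConj_smul_infinitePlace L σ.1) (IsCMField.complexConj_ne_one L)
              (UnitaryGroup.archPart (Fp L) L (IsCMField.complexConj L) (2 + 2) (hermD L e dV hdV dW hdW) h) :
                UnitaryGroup.archLocal L (2 + 2) (hermD L e dV hdV dW hdW) σ) : GL (Fin (2 + 2)) ℂ) : Matrix (Fin (2 + 2)) (Fin (2 + 2)) ℂ) * Tinv σ =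
        Matrix.fromBlocks (y σ) (b σ) 0 (d σ) * κ σ) →
      ∃ t : {w : InfinitePlace L // w.IsComplex} → ℝ,
        (∀ σ a b, ‖((y σ)ᴴ * (A σ * ((S : Matrix (Fin 2) (Fin 2) L).map σ.1.embedding) * B σ) * y σ) a b‖ ≤ t σ) ∧
        (∀ σ, t σ ≤ Kt * ∑ a, ∑ b, ‖((y σ)ᴴ * (A σ * ((S : Matrix (Fin 2) (Fin 2) L).map σ.1.embedding) * B σ) * y σ) a b‖) ∧
        ‖Finf j S s h‖ ≤ C * adelicHeightGL (2 + 2) L (h : GL (Fin (2 + 2)) (AdeleRing (𝓞 L) L)) ^ a *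
          ∏ σ, (Real.exp (-(cg * t σ)) * (1 + t σ) ^ Ng *
            (1 + ‖((y σ)ᴴ * (A σ * ((S : Matrix (Fin 2) (Fin 2) L).map σ.1.embedding) * B σ) * y σ).det‖ ^ (-N'g))) := by
  -- (L3) BY NAME: the two-sided height letter ★ p864255 at the frames of record, and the height floor ★ G7-C
  obtain ⟨Ch, ah, hCh, hah, hHY'⟩ := hHt_of_frame (Fp L) L (IsCMField.complexConj L) (2 + 2) (hermD L e dV hdV dW hdW) (IsCMField.complexConj_ne_one L)
    (fun σ : {w : InfinitePlace L // w.IsComplex} => σ) (fun σ => UnitaryGroup.complexConj_smul_infinitePlace L σ.1) (e₂ (n := 2)) T Tinv hT1 hT2 hM hTe hTe'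
  obtain ⟨c₀, hc₀, hfloor⟩ := exists_adelicHeightGL_floor L (2 + 2)
  have hc₁ : 0 < min 1 c₀ := lt_min one_pos hc₀
  intro z hz
  obtain ⟨Cg, cg, N, N', r₂, hCg, hcg, hN, hN', hr₂, hmain⟩ := hWgrU z hz
  choose Ew hEw using hmain
  have hMG0 : 0 ≤ ∑ w : {w : InfinitePlace L // w.IsComplex}, ∑ i, ∑ j, ‖Fr g w i j‖ :=
    Finset.sum_nonneg fun _ _ => Finset.sum_nonneg fun _ _ => Finset.sum_nonneg fun _ _ => norm_nonneg _
  obtain ⟨MG, hMG⟩ : ∃ MG : ℝ, MG = 1 + ∑ w : {w : InfinitePlace L // w.IsComplex}, ∑ i, ∑ j, ‖Fr g w i j‖ := ⟨_, rfl⟩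
  have hMG1 : 1 ≤ MG := by rw [hMG]; linarith
  have hGb : ∀ (w : {w : InfinitePlace L // w.IsComplex}) i j, ‖Fr g w i j‖ ≤ MG := fun w i j => by
    have h1 : ‖Fr g w i j‖ ≤ ∑ j', ‖Fr g w i j'‖ :=
      Finset.single_le_sum (f := fun j' => ‖Fr g w i j'‖) (fun _ _ => norm_nonneg _) (Finset.mem_univ j)
    have h2 : ∑ j', ‖Fr g w i j'‖ ≤ ∑ i', ∑ j', ‖Fr g w i' j'‖ :=
      Finset.single_le_sum (f := fun i' => ∑ j', ‖Fr g w i' j'‖) (fun _ _ => Finset.sum_nonneg fun _ _ => norm_nonneg _) (Finset.mem_univ i)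
    have h3 : ∑ i', ∑ j', ‖Fr g w i' j'‖ ≤ ∑ w' : {w : InfinitePlace L // w.IsComplex}, ∑ i', ∑ j', ‖Fr g w' i' j'‖ :=
      Finset.single_le_sum (f := fun w' : {w : InfinitePlace L // w.IsComplex} => ∑ i', ∑ j', ‖Fr g w' i' j'‖)
        (fun _ _ => Finset.sum_nonneg fun _ _ => Finset.sum_nonneg fun _ _ => norm_nonneg _) (Finset.mem_univ w)
    rw [hMG]; linarith
  have hMM : (16 : ℝ) ≤ 16 * M * MG := by nlinarith
  have hK₀ : (1 : ℝ) ≤ 2 * (16 * M * MG) ^ 2 := by nlinarith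
  have hK₁ : (1 : ℝ) ≤ 4 * (16 * M * MG) ^ 2 := by nlinarith
  have hK₂ : (1 : ℝ) ≤ 4 * (16 * M * MG) ^ 4 := by nlinarith [pow_le_pow_left₀ (by norm_num : (0:ℝ) ≤ 16) hMM 4]
  obtain ⟨E, hE⟩ : ∃ E : ℝ, E = |2 - 2 * z.re| + 2 := ⟨_, rfl⟩
  have hE0 : 0 ≤ E := by rw [hE]; positivity
  obtain ⟨Kc, hKc⟩ : ∃ Kc : ℝ, Kc = Cg * (2 * (16 * M * MG) ^ 2) ^ E * (4 * (16 * M * MG) ^ 2) ^ N * (4 * (16 * M * MG) ^ 4) ^ N' := ⟨_, rfl⟩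
  have hKc0 : 0 ≤ Kc := by
    rw [hKc]
    exact mul_nonneg (mul_nonneg (mul_nonneg hCg (Real.rpow_nonneg (by linarith) _)) (Real.rpow_nonneg (by linarith) _)) (Real.rpow_nonneg (by linarith) _)
  have hPC : 0 < ∏ w : {w : InfinitePlace L // w.IsComplex}, ‖(Cx w).det‖ := Finset.prod_pos fun w _ => norm_pos_iff.2 (hCu w).ne_zero
  obtain ⟨CC, hCC⟩ : ∃ CC : ℝ, CC = max 1 (max (∏ w : {w : InfinitePlace L // w.IsComplex}, ‖(Cx w).det‖) (∏ w : {w : InfinitePlace L // w.IsComplex}, ‖(Cx w).det‖)⁻¹) := ⟨_, rfl⟩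
  have hCC1 : 1 ≤ CC := by rw [hCC]; exact le_max_left _ _
  obtain ⟨Ex, hEx⟩ : ∃ Ex : ℝ, Ex = 2 * |z.re - s₀.re| + 2 := ⟨_, rfl⟩
  obtain ⟨Cx', hCx'⟩ : ∃ Cx' : ℝ, Cx' = max 1 (max xK xK⁻¹) := ⟨_, rfl⟩
  have hCx'1 : 1 ≤ Cx' := by rw [hCx']; exact le_max_left _ _
  have hcsum0 : 0 ≤ ∑ j' : Fin m, ∑ i, ‖c j' i‖ := Finset.sum_nonneg fun _ _ => Finset.sum_nonneg fun _ _ => norm_nonneg _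
  refine ⟨cg / (4 * (16 * M * MG) ^ 2), N, N', 1,
    Cx' ^ Ex * (∑ j' : Fin m, ∑ i, ‖c j' i‖) * |cν| * (Kc ^ Fintype.card {w : InfinitePlace L // w.IsComplex} * CC ^ E * (Ch ^ E * (min 1 c₀) ^ (-(ah * E)))), ah * E, min r₂ (min 1 z.re),
    div_pos hcg (by linarith), hN, hN', le_rfl, ?_, mul_nonneg hah hE0, lt_min hr₂ (lt_min one_pos hz), ?_⟩
  · exact mul_nonneg (mul_nonneg (mul_nonneg (Real.rpow_nonneg (by linarith) _) hcsum0) (abs_nonneg _))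
      (mul_nonneg (mul_nonneg (pow_nonneg hKc0 _) (Real.rpow_nonneg (by linarith) _)) (mul_nonneg (Real.rpow_nonneg (by linarith) _) (Real.rpow_nonneg hc₁.le _)))
  intro j S s hs hdet h y b d κ κ' hκ1 hκ2 hκb hκ'b hread
  -- the index identity `A σ · σS · B σ = h_σ(S)` (the framed index of ★ p863806)
  have hHm : ∀ w : {w : InfinitePlace L // w.IsComplex}, A w * ((S : Matrix (Fin 2) (Fin 2) L).map w.1.embedding) * B w = ((-2 : ℂ) • ((T w).toBlocks₂₂ * (S : Matrix (Fin 2) (Fin 2) L).map w.1.embedding * (Tinv w).toBlocks₁₁)) := fun w => by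
    rw [hA, hB, Matrix.smul_mul, Matrix.smul_mul]
  refine ⟨fun σ => ∑ a, ∑ b, ‖((y σ)ᴴ * (A σ * ((S : Matrix (Fin 2) (Fin 2) L).map σ.1.embedding) * B σ) * y σ) a b‖, fun σ a b' => ?_,
    fun σ => by rw [one_mul], ?_⟩
  · exact (Finset.single_le_sum (f := fun b'' => ‖((y σ)ᴴ * (A σ * ((S : Matrix (Fin 2) (Fin 2) L).map σ.1.embedding) * B σ) * y σ) a b''‖)
        (fun _ _ => norm_nonneg _) (Finset.mem_univ b')).trans
      (Finset.single_le_sum (f := fun a' => ∑ b'', ‖((y σ)ᴴ * (A σ * ((S : Matrix (Fin 2) (Fin 2) L).map σ.1.embedding) * B σ) * y σ) a' b''‖)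
        (fun _ _ => Finset.sum_nonneg fun _ _ => norm_nonneg _) (Finset.mem_univ a))
  have hsr₂ : dist s z < r₂ := lt_of_lt_of_le hs (min_le_left _ _)
  have hsz1 : ‖s - z‖ < 1 := by rw [← Complex.dist_eq]; exact lt_of_lt_of_le hs ((min_le_right _ _).trans (min_le_left _ _))
  have hszre : ‖s - z‖ < z.re := by rw [← Complex.dist_eq]; exact lt_of_lt_of_le hs ((min_le_right _ _).trans (min_le_right _ _))
  have hdre : |s.re - z.re| ≤ ‖s - z‖ := by simpa only [Complex.sub_re] using Complex.abs_re_le_norm (s - z)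
  have hsre : 0 < s.re := by have := abs_lt.1 (lt_of_le_of_lt hdre hszre); linarith
  have hdre1 := abs_lt.1 (lt_of_le_of_lt hdre hsz1)
  have he : |2 - 2 * s.re| ≤ E := by
    rw [hE]
    calc |2 - 2 * s.re| = |(2 - 2 * z.re) + 2 * (z.re - s.re)| := by ring_nf
      _ ≤ |2 - 2 * z.re| + |2 * (z.re - s.re)| := abs_add_le _ _
      _ ≤ |2 - 2 * z.re| + 2 := by
          have h2 : |2 * (z.re - s.re)| ≤ 2 := by
            rw [abs_mul, abs_two, abs_sub_comm]
            have : |s.re - z.re| ≤ 1 := (abs_lt.2 hdre1).le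
            linarith
          linarith
  obtain ⟨Ew', hEw'⟩ : ∃ Ew' : ιQ → skewMatrices ((IsCMField.complexConj L : L ≃ₐ[Fp L] L) : L →+* L) ((gramR L e dV hdV dW hdW).map (algebraMap (Fp L) L)) → HA L e dV hdV dW hdW → {w : InfinitePlace L // w.IsComplex} → ℂ → ℂ,
      ∀ (i : ιQ) (S' : skewMatrices ((IsCMField.complexConj L : L ≃ₐ[Fp L] L) : L →+* L) ((gramR L e dV hdV dW hdW).map (algebraMap (Fp L) L)))
        (h' : HA L e dV hdV dW hdW) (w : {w : InfinitePlace L // w.IsComplex}),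
        Ew' i S' h' w = if hS' : (S' : Matrix (Fin 2) (Fin 2) L).det ≠ 0 then Ew w i S' hS' h' else 0 :=
    ⟨fun i S' h' w => if hS' : (S' : Matrix (Fin 2) (Fin 2) L).det ≠ 0 then Ew w i S' hS' h' else 0, fun _ _ _ _ => rfl⟩
  have hEw'S : ∀ i w, Ew' i S h w = Ew w i S hdet h := fun i w => by rw [hEw', dif_pos hdet]
  have hid := hchain Ew' (fun i S' h' w hS' s' hs' F hF hQ => by
    rw [hEw', dif_pos hS']
    exact (hEw w i S' hS' h').2.1 s' hs' F hF hQ) j S h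
  obtain ⟨Φ, hΦ⟩ : ∃ Φ : ℂ → ℂ, Φ = fun s' => Cst s' * ∑ i, c j i * ((cν : ℂ) * ∏ w, Ew' i S h w s') := ⟨_, rfl⟩
  have hCstd : Differentiable ℂ Cst := by
    have hx0 : ((xK : ℝ) : ℂ) ≠ 0 := by exact_mod_cast hxK.ne'
    have : Cst = fun s' => ((xK : ℝ) : ℂ) ^ (2 * (s' - s₀)) := funext hCst
    rw [this]
    exact ((differentiable_id.sub_const s₀).const_mul (2 : ℂ)).const_cpow (Or.inl hx0)
  have hΦdiff : DifferentiableOn ℂ Φ {s' : ℂ | 0 < s'.re} := by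
    rw [hΦ]
    refine hCstd.differentiableOn.mul (DifferentiableOn.fun_sum fun i _ => DifferentiableOn.const_mul ?_ _)
    refine DifferentiableOn.const_mul ?_ _
    refine differentiableOn_finset_prod _ _ (fun w s' => Ew' i S h w s') fun w _ => ?_
    have : (fun s' => Ew' i S h w s') = Ew w i S hdet h := funext fun s' => by rw [hEw'S]
    rw [this]
    exact (hEw w i S hdet h).1
  have hΦeq : ∀ s' : ℂ, ((2 : ℕ) : ℝ) / 2 < s'.re → Φ s' =
      archWhittakerIntegral L e dV hdV dW hdW (νinf (kindWFinset L e dV hdV dW hdW T₀ (S : Matrix (Fin 2) (Fin 2) L) h)) (S : Matrix (Fin 2) (Fin 2) L)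
        (FinfT j S h) (UnitaryGroup.archPart (Fp L) L (IsCMField.complexConj L) (2 + 2) (hermD L e dV hdV dW hdW) h) s' := fun s' hs' => by
    rw [hΦ]
    exact (hid s' hdet (lt_of_le_of_lt hs₁ (by norm_num at hs'; exact hs'))).symm
  have hFinf_eq : Finf j S s h = Φ s := by
    rw [hFinf, if_neg hdet]
    exact kindWArchLetter_eqOn L e dV hdV dW hdW νinf T₀ FinfT j S h ⟨hΦdiff, hΦeq⟩ hsre
  -- the size faces are non-negative (explicit terms: no `positivity` on matrix-entry atoms)
  have hSy0 : ∀ w : {w : InfinitePlace L // w.IsComplex},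
      0 ≤ ∑ a, ∑ b', ‖((y w)ᴴ * (A w * ((S : Matrix (Fin 2) (Fin 2) L).map w.1.embedding) * B w) * y w) a b'‖ := fun w =>
    Finset.sum_nonneg fun _ _ => Finset.sum_nonneg fun _ _ => norm_nonneg _
  have hZw : ∀ w : {w : InfinitePlace L // w.IsComplex}, 0 ≤
      Real.exp (-(cg / (4 * (16 * M * MG) ^ 2) * ∑ a, ∑ b', ‖((y w)ᴴ * (A w * ((S : Matrix (Fin 2) (Fin 2) L).map w.1.embedding) * B w) * y w) a b'‖)) *
        (1 + ∑ a, ∑ b', ‖((y w)ᴴ * (A w * ((S : Matrix (Fin 2) (Fin 2) L).map w.1.embedding) * B w) * y w) a b'‖) ^ N *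
        (1 + ‖((y w)ᴴ * (A w * ((S : Matrix (Fin 2) (Fin 2) L).map w.1.embedding) * B w) * y w).det‖ ^ (-N')) := fun w =>
    mul_nonneg (mul_nonneg (Real.exp_pos _).le (Real.rpow_nonneg (add_nonneg zero_le_one (hSy0 w)) _))
      (add_nonneg zero_le_one (Real.rpow_nonneg (norm_nonneg _) _))
  have hface : ∀ (i : ιQ) (w : {w : InfinitePlace L // w.IsComplex}), ‖Ew' i S h w s‖ ≤ Kc * (‖(Cx w).det‖ * ‖(y w).det‖) ^ (2 - 2 * s.re) *
      (Real.exp (-(cg / (4 * (16 * M * MG) ^ 2) * ∑ a, ∑ b', ‖((y w)ᴴ * (A w * ((S : Matrix (Fin 2) (Fin 2) L).map w.1.embedding) * B w) * y w) a b'‖)) *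
        (1 + ∑ a, ∑ b', ‖((y w)ᴴ * (A w * ((S : Matrix (Fin 2) (Fin 2) L).map w.1.embedding) * B w) * y w) a b'‖) ^ N *
        (1 + ‖((y w)ᴴ * (A w * ((S : Matrix (Fin 2) (Fin 2) L).map w.1.embedding) * B w) * y w).det‖ ^ (-N'))) := by
    intro i w
    have hPt : (Fr (UnitaryGroup.archPart (Fp L) L (IsCMField.complexConj L) (2 + 2) (hermD L e dV hdV dW hdW) h * g) w)ᴴ * Matrix.J (Fin 2) ℂ *
        Fr (UnitaryGroup.archPart (Fp L) L (IsCMField.complexConj L) (2 + 2) (hermD L e dV hdV dW hdW) h * g) w = Matrix.J (Fin 2) ℂ :=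
      frame_mem L e dV hdV dW hdW T Tinv Fr hFr hTU _ w
    have hLv : (fromBlocks (Cx w) 0 0 (-(Bx w)) : Matrix (Fin 2 ⊕ Fin 2) (Fin 2 ⊕ Fin 2) ℂ)ᴴ * Matrix.J (Fin 2) ℂ *
        (fromBlocks (Cx w) 0 0 (-(Bx w)) : Matrix (Fin 2 ⊕ Fin 2) (Fin 2 ⊕ Fin 2) ℂ) = Matrix.J (Fin 2) ℂ :=
      (levi_mem_iff (Cx w) (-(Bx w))).2 (by rw [Matrix.mul_neg, (antidiag_letters (hx w)).1, neg_neg])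
    obtain ⟨X₀, R, u₀, hX₀, hR, hRu, hu₀, hu₀I, hdec⟩ := exists_transl_levi_mul_stabilizer (mul_mem_UJ hLv hPt)
    have hbd := (hEw w i S hdet h).2.2 s hsr₂ X₀ R u₀ hX₀ hR hRu hu₀ hu₀I hdec
    have hFrhg : Fr (UnitaryGroup.archPart (Fp L) L (IsCMField.complexConj L) (2 + 2) (hermD L e dV hdV dW hdW) h * g) w =
        fromBlocks (y w) (b w) 0 (d w) * κ w * Fr g w := by
      rw [frame_mul L e dV hdV dW hdW T Tinv Fr hFr hT2, hFr (UnitaryGroup.archPart (Fp L) L (IsCMField.complexConj L) (2 + 2) (hermD L e dV hdV dW hdW) h) w, hread w]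
    rw [hFrhg] at hdec
    have hGmem : (Fr g w)ᴴ * Matrix.J (Fin 2) ℂ * Fr g w = Matrix.J (Fin 2) ℂ := frame_mem L e dV hdV dW hdW T Tinv Fr hFr hTU g w
    have key := placeFace_le_of_iwasawa (hx w) (hCu w) hGmem hMG1 (hGb w) (hκ1 w) hM (hκb w) (hκ'b w) hR hRu hu₀ hu₀I hdec
      (framedIndex_det_ne_zero_of_frame L e dV hdV dW hdW T Tinv hTdef hTinvdef hdV0 hdW0 (S : Matrix (Fin 2) (Fin 2) L) hdet w)
      hCg hcg.le hN hN' he (Ev := ‖Ew' i S h w s‖) (by rw [hEw'S]; exact hbd)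
    rw [← hHm w] at key
    rw [hKc]
    calc ‖Ew' i S h w s‖ ≤ _ := key
      _ = _ := by ring
  have hF0 : ∀ w : {w : InfinitePlace L // w.IsComplex}, 0 ≤ Kc * (‖(Cx w).det‖ * ‖(y w).det‖) ^ (2 - 2 * s.re) *
      (Real.exp (-(cg / (4 * (16 * M * MG) ^ 2) * ∑ a, ∑ b', ‖((y w)ᴴ * (A w * ((S : Matrix (Fin 2) (Fin 2) L).map w.1.embedding) * B w) * y w) a b'‖)) *
        (1 + ∑ a, ∑ b', ‖((y w)ᴴ * (A w * ((S : Matrix (Fin 2) (Fin 2) L).map w.1.embedding) * B w) * y w) a b'‖) ^ N *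
        (1 + ‖((y w)ᴴ * (A w * ((S : Matrix (Fin 2) (Fin 2) L).map w.1.embedding) * B w) * y w).det‖ ^ (-N'))) := fun w =>
    mul_nonneg (mul_nonneg hKc0 (Real.rpow_nonneg (mul_nonneg (norm_nonneg _) (norm_nonneg _)) _)) (hZw w)
  obtain ⟨hYpos, hY1, hY2⟩ := hHY' h y b d κ κ' hκ1 hκ2 hκb hκ'b hread
  have hY1' : (∏ σ, ‖(y σ).det‖) ≤ Ch * adelicHeightGL (2 + 2) L (h : GL (Fin (2 + 2)) (AdeleRing (𝓞 L) L)) ^ ah := hY1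
  have hY2' : (∏ σ, ‖(y σ).det‖)⁻¹ ≤ Ch * adelicHeightGL (2 + 2) L (h : GL (Fin (2 + 2)) (AdeleRing (𝓞 L) L)) ^ ah := hY2
  have hnorm := norm_chain_le (Cst s) (c j) cν (fun i w => Ew' i S h w s) _ hF0 (fun i w => hface i w)
  have hsplit := prod_face_split Kc (2 - 2 * s.re) (fun w : {w : InfinitePlace L // w.IsComplex} => ‖(Cx w).det‖) (fun w => ‖(y w).det‖)
    (fun w => Real.exp (-(cg / (4 * (16 * M * MG) ^ 2) * ∑ a, ∑ b', ‖((y w)ᴴ * (A w * ((S : Matrix (Fin 2) (Fin 2) L).map w.1.embedding) * B w) * y w) a b'‖)) *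
        (1 + ∑ a, ∑ b', ‖((y w)ᴴ * (A w * ((S : Matrix (Fin 2) (Fin 2) L).map w.1.embedding) * B w) * y w) a b'‖) ^ N *
        (1 + ‖((y w)ᴴ * (A w * ((S : Matrix (Fin 2) (Fin 2) L).map w.1.embedding) * B w) * y w).det‖ ^ (-N')))
    (fun w => norm_nonneg _) (fun w => norm_nonneg _)
  have hCstB : ‖Cst s‖ ≤ Cx' ^ Ex := by
    rw [hCst, Complex.norm_cpow_eq_rpow_re_of_pos hxK]
    have hre : (2 * (s - s₀)).re = 2 * (s.re - s₀.re) := by simp [Complex.mul_re, Complex.sub_re]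
    rw [hre]
    have hex : |2 * (s.re - s₀.re)| ≤ Ex := by
      rw [hEx, abs_mul, abs_two]
      have : |s.re - s₀.re| ≤ |z.re - s₀.re| + 1 := by
        calc |s.re - s₀.re| = |(s.re - z.re) + (z.re - s₀.re)| := by ring_nf
          _ ≤ |s.re - z.re| + |z.re - s₀.re| := abs_add_le _ _
          _ ≤ |z.re - s₀.re| + 1 := by linarith [(abs_lt.2 hdre1).le]
      linarith
    have h := rpow_le_of_two_sided_height (P := xK) (Ch := Cx') (ah := 0) (H := 1) hxK hCx'1 le_rfl le_rfl
      (by rw [Real.rpow_zero, mul_one, hCx']; exact (le_max_left _ _).trans (le_max_right _ _))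
      (by rw [Real.rpow_zero, mul_one, hCx']; exact (le_max_right _ _).trans (le_max_right _ _)) hex
    rwa [zero_mul, Real.rpow_zero, mul_one] at h
  have hcj : ∑ i, ‖c j i‖ ≤ ∑ j' : Fin m, ∑ i, ‖c j' i‖ :=
    Finset.single_le_sum (f := fun j' : Fin m => ∑ i, ‖c j' i‖) (fun _ _ => Finset.sum_nonneg fun _ _ => norm_nonneg _) (Finset.mem_univ j)
  have hPCe : (∏ w : {w : InfinitePlace L // w.IsComplex}, ‖(Cx w).det‖) ^ (2 - 2 * s.re) ≤ CC ^ E := by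
    have h := rpow_le_of_two_sided_height (P := ∏ w : {w : InfinitePlace L // w.IsComplex}, ‖(Cx w).det‖) (Ch := CC) (ah := 0) (H := 1) hPC hCC1 le_rfl le_rfl
      (by rw [Real.rpow_zero, mul_one, hCC]; exact (le_max_left _ _).trans (le_max_right _ _))
      (by rw [Real.rpow_zero, mul_one, hCC]; exact (le_max_right _ _).trans (le_max_right _ _)) he
    rwa [zero_mul, Real.rpow_zero, mul_one] at h
  have hPYe := rpow_le_of_two_sided_height_floor hYpos hCh hah hc₁ (min_le_left _ _) ((min_le_right _ _).trans (hfloor _)) hY1' hY2' he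
  rw [hFinf_eq, hΦ]
  refine hnorm.trans ?_
  rw [hsplit]
  exact tail_bound hCstB hcj (Real.rpow_nonneg (le_trans zero_le_one hCx'1) _) (Finset.sum_nonneg fun _ _ => norm_nonneg _) (abs_nonneg _)
    (pow_nonneg hKc0 _) (Real.rpow_nonneg hPC.le _) hPCe (Real.rpow_nonneg hYpos.le _) hPYe (Real.rpow_nonneg (le_trans zero_le_one hCC1) _)
    (Finset.prod_nonneg fun w _ => hZw w)

end Head

end Summit.HodgeConjecture.HodgeConjecture.Cruxes.HLiu418.K2LiuKindWArchBlockLetterOfPlaceGrowth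

end
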